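import Literature.AlgebraicGeometry.Shioda1982.ExceptionalQuadruplesSweepTwoHundredThirtyFourPartOne
import HarnessLib

/-!
# Shioda 1982 / Meyer–Neutsch 1981: no exceptional quadruple at the level `N = 234` — kernel sweep, part 2 of 2 and assembly

Topic `Literature/AlgebraicGeometry/Shioda1982`; companion of `ExceptionalQuadruplesComplete.lean` (search `checkB`, soundness
`tabelleOneCompleteAt_of_chunks`, invariant form `exists_mem_reps_of_isExceptionalQuadruple`, statement `TabelleOneCompleteAt`; sources,
method and framing in its module docstring) and of the series `ExceptionalQuadruplesSweep*.lean` (together: every level `2 ≤ N ≤ 180`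
that is not a row of Tabelle 1; `…SweepTwoHundredTwenty.lean`: `N = 220`). THEOREMS only (no definition, no named fact): the same kernel
search at the single level `N = 234`, which carries NO row of [MeyerNeutsch1981Fermatquadrupel, Tabelle 1] (computer-generated there,
"alle Fermatquadrupel für N ≤ 614 ermittelt", §2 p. 53) and lies above the range `N ≤ 180` of Shioda's table p. 727 — by Aoki's
Theorem C ([Aoki1983], computer-assisted for `181 ≤ m ≤ 672`) there is no exceptional element at any level `> 180`; the files
`ExceptionalQuadruplesSweepTwoHundredThirtyFourPartOne.lean`, `ExceptionalQuadruplesSweepTwoHundredThirtyFour.lean` make the instance `N = 234` a kernel statement. The search at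
`N = 234` visits 362778 candidate triples (`φ(234) − 1 = 71` units each), too many for one elaboration of bounded wall time, so the
chunks of first entries are spread over 2 files: `ExceptionalQuadruplesSweepTwoHundredThirtyFourPartOne.lean` — first entries `0 ≤ a < 36` (175797 candidates);
`ExceptionalQuadruplesSweepTwoHundredThirtyFour.lean` — first entries `36 ≤ a < 234` (186981 candidates); the last one assembles
`completeAt_twoHundredThirtyFour` (every sorted pair-free primitive Hodge 4-multiset mod `234` is standard) and `not_isExceptionalQuadruple_twoHundredThirtyFour`.
WHY THIS LEVEL (cell `pub-hfermat`): `234 = 18·13`, the instance `p = 13` of the family `m = 18p` of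
`HodgeQuadruplesEighteenPrime.lean` (`classify_hodgeMultiset_eighteenPrime`, `p ≥ 17`) below its range — a residual prime of
`PicardNumberEighteenPrime.lean` (`exceptional_eighteenPrime`). `decide +kernel` only (no `native_decide`).

HONEST FRAMING (cell `pub-hfermat`): explicit algebraic cycles for specific Hodge classes on Fermat/Delsarte varieties; residual open
instances listed; no claim on general Hodge. These classes are algebraic (Lefschetz (1,1)); certified here is only the emptiness of the
exceptional list at this level.

## References
* [MeyerNeutsch1981Fermatquadrupel] W. Meyer, W. Neutsch, *Fermatquadrupel*, Math. Ann. 256 (1981) 51–62, §2 p. 53, Tabelle 1 p. 54 (no row 234).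
* [Shioda1982PicardFermat] T. Shioda, J. Fac. Sci. Univ. Tokyo IA 28 (1982) 725–734, table p. 727 (levels `≤ 180`), Prop. 4 (Q′) p. 729.
* [Aoki1983] N. Aoki, Math. Ann. 266 (1983) 23–54, Thm. C.
-/

namespace Literature.AlgebraicGeometry.Shioda1982

open Literature.AlgebraicGeometry.HodgeTheory

set_option maxHeartbeats 0 in
/-- **The search at `N = 234` passes on the first entries `36 ≤ a < 234`** (part 2 of 2: 10 chunks, 186981 candidate
triples): every visited sorted quadruple of representatives there fails the Hodge test or is standard (`checkB`; `reps 234 = []`).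
[cite: MeyerNeutsch1981Fermatquadrupel, §2 p. 53 ("alle Fermatquadrupel für N ≤ 614 ermittelt") and Tabelle 1 p. 54 (no row 234)]
[cite: Aoki1983, Thm. C] -/
theorem checkB_twoHundredThirtyFour_partTwo :
    ∀ p ∈ ([(36, 4), (40, 4), (44, 4), (48, 5), (53, 5), (58, 6), (64, 7), (71, 9), (80, 19), (99, 135)] : List (ℕ × ℕ)), checkB 234 p.1 p.2 = true := by
  intro p hp
  simp only [List.mem_cons, List.not_mem_nil, or_false] at hp
  rcases hp with rfl | rfl | rfl | rfl | rfl | rfl | rfl | rfl | rfl | rfl <;> decide +kernel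

set_option maxHeartbeats 0 in
/-- **Tabelle 1 is complete at `N = 234`, where it is empty**: every sorted Hodge 4-multiset mod `234` without a pair and with
`gcd = 1` is standard. Kernel exhaustion (`checkB`, 19 chunks of first entries in 2 files, 362778 candidate triples:
`checkB_twoHundredThirtyFour_partOne`, `checkB_twoHundredThirtyFour_partTwo`).
[cite: MeyerNeutsch1981Fermatquadrupel, §2 p. 53 ("alle Fermatquadrupel für N ≤ 614 ermittelt") and Tabelle 1 p. 54 (no row 234)]
[cite: Aoki1983, Thm. C] [cite: Shioda1982PicardFermat, Prop. 4 (Q′) p. 729] -/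
theorem completeAt_twoHundredThirtyFour : TabelleOneCompleteAt 234 :=
  tabelleOneCompleteAt_of_chunks 234 ([(0, 4), (4, 4), (8, 4), (12, 4), (16, 4), (20, 4), (24, 4), (28, 4), (32, 4)] ++ [(36, 4), (40, 4), (44, 4), (48, 5), (53, 5), (58, 6), (64, 7), (71, 9), (80, 19), (99, 135)]) (by decide +kernel) (by
    intro p hp
    rcases List.mem_append.mp hp with hp | hp
    · exact checkB_twoHundredThirtyFour_partOne p hp
    · exact checkB_twoHundredThirtyFour_partTwo p hp)

/-- **No exceptional quadruple ("Ausnahmequadrupel") at the level `234`** (`tabelleOne 234 = []`).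
[cite: MeyerNeutsch1981Fermatquadrupel, Tabelle 1 p. 54 (no row 234)] [cite: Aoki1983, Thm. C] -/
theorem not_isExceptionalQuadruple_twoHundredThirtyFour (s : Multiset (ZMod 234)) : ¬ IsExceptionalQuadruple 234 s := by
  intro hs
  obtain ⟨r, hr, -⟩ := exists_mem_reps_of_isExceptionalQuadruple completeAt_twoHundredThirtyFour hs
  simp [reps, tabelleOne] at hr

end Literature.AlgebraicGeometry.Shioda1982
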